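import Literature.AlgebraicGeometry.Motives.AbelianVarietyArtinSolomonRelationIsogenies
import Literature.AlgebraicGeometry.Motives.AbelianVarietySymmetricThreeBrauerRelations
import Literature.NumberTheory.DiophantineGeometry.AVKernelHopf
import Mathlib.LinearAlgebra.TensorProduct.Prod
import Mathlib.LinearAlgebra.Dimension.Constructions
import HarnessLib

/-!
# `A(L) ⊗ ℚ` is an ISOGENY INVARIANT and is ADDITIVE, so the Mordell–Weil ranks obey every Kani–Rosen /
# Brauer-relation isogeny: `rk (A × B)(L) = rk A(L) + rk B(L)`, `A ∼ B ⟹ A(L) ⊗ ℚ ≅ B(L) ⊗ ℚ`,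
# `Σ_i n_i rk B_{H_i}(L) = 0` — ALGEBRAIC carrier, any base field, points over any extension field `L`

Layer A1/A2 of the Hodge foundations lane (`lit-hodgefound`, row A1-20⁺ · A2, seat p03 generation 29, row g29-#3), the
Mordell–Weil sequel of `Motives/AbelianVarietyPointCountIsogenyInvariance` (g29-#1, `#B(𝔽_{q^m})`) and
`Motives/AbelianVarietyGaloisCharpolyIsogenyRelations` (g29-#2, `charpoly(σ | T_ℓ B)`) in the series of ARITHMETIC SHADOWS
of the Kani–Rosen / Brauer-relation isogenies on the ALGEBRAIC carrier `AbelianVariety K` of `Motives/AbelianVariety`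
(`…ArtinSolomonRelationIsogenies` = Kani–Rosen's Theorem 3: `Σ_i n_i (1_{H_i})^G = 0 ⟹ ∏_{n_i>0} B_{H_i}^{n_i} ∼
∏_{n_i<0} B_{H_i}^{-n_i}`; `…IdempotentRelations` = Theorem B; `…BrauerRelationIsogenies` (Gassmann);
`…SymmetricThreeBrauerRelations`: `B_{C_2}² × B_{C_3} ∼ X × B_{S_3}²`).  The functor read here is the group of rational
points tensored with `ℚ`, `F(A) = A(L) ⊗_ℤ ℚ` for a field `L ⊇ K` (`A(L) = A.Points L = Hom_K(Spec L, A)`, an abelian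
group under the group law of `A`; on homomorphisms Mathlib's `IsMonHom.monoidHom f (Spec L)`, `P ↦ P ≫ f`):

* `F` is ADDITIVE in `f` (`(f + g)(P) = f(P) + g(P)`: the group law is a `K`-morphism, Mathlib `MonObj.comp_mul`) and a
  functor, so `[n]_A` acts on `A(L)` as multiplication by `n`;
* an isogeny `f : A → B` has a quasi-inverse `g` with `g f = [n]_A`, `f g = [n]_B`, `n ≥ 1` (the tree's
  `IsIsogeny.exists_nsmul_inverse_holds`, `…/AVKernelHopf`, Mumford §19 Remark p. 169), and `n` is invertible in `ℚ`:
  **`A ∼ B ⟹ A(L) ⊗ ℚ ≅ B(L) ⊗ ℚ`** (`ℚ`-linearly), in particular `rk A(L) = rk B(L)`;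
* `F` carries Mathlib's biproduct `A ⊞ B` to `A(L) × B(L)` (`(A ⊞ B)(L) ≃+ A(L) × B(L)` by `P ↦ (fst P, snd P)` —
  Dokchitser–Green–Konstantinou–Morgan's "additive functor lemma"), so **`rk (A ⊞ B)(L) = rk A(L) + rk B(L)`** and
  `rk (⨁_i A_i)(L) = Σ_i rk A_i(L)` whenever the ranks are finite;

whence every isogeny `∏_i Y_i^{a_i} ∼ ∏_j Z_j^{b_j}` of the series gives `Σ_i a_i rk Y_i(L) = Σ_j b_j rk Z_j(L)`:
for a Brauer relation **`Σ_i n_i rk B_{H_i}(L) = 0`**, for Theorem B `(t-1) rk X(L) + |G| rk B_G(L) = Σ_i |H_i| rk B_{H_i}(L)`,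
for Gassmann equivalent `H₁, H₂` `rk B_{H₁}(L) = rk B_{H₂}(L)`, for `S_3` `2 rk B_{C_2}(L) + rk B_{C_3}(L) = rk X(L) +
2 rk B_{S_3}(L)` — the rank formulae that "isogenies have been extensively used to derive" (DGKM).  Here
`rk A(L) := dim_ℚ (ℚ ⊗_ℤ A(L))` (Mathlib `Module.finrank`, junk value `0` when `A(L) ⊗ ℚ` is infinite-dimensional); the
rank identities are stated under the hypothesis that the `B(L) ⊗ ℚ` involved are finite-dimensional (for `L` a number
field this is the Mordell–Weil theorem, not in this file), the `ℚ`-linear isomorphisms unconditionally.  Everything here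
is PROVED; the file introduces NO definition and NO named fact (net Literature debt 0).

## Sources, verbatim

V. Dokchitser, H. Green, A. Konstantinou, A. Morgan, *Parity of ranks of Jacobians of curves*, Proc. LMS (2025)
(arXiv 2211.06357, held `paper:arxiv-2211.06357`), §1.3 (p0004): "For every Brauer relation `Θ = Σ_i H_i − Σ_j H_j'` for
`G`, there is an isogeny `∏_j Jac_{X/H_j'} → ∏_i Jac_{X/H_i}`"; §1 (p0005): "Isogenies have been extensively used to
derive formulae for various ranks in terms of local data."; §3 (p0013): "**Lemma.** Let `E` be a field of characteristic
coprime to `|G|`, and let `F` be an additive (covariant) functor from the category of abelian varieties over `k` to the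
category of finite dimensional `E`-vector spaces. […] since `F` is additive, commutativity of the diagram formally
reduces to the case where `S = G/H` and `S' = G/H'`"; (p0003): "if a representation `ρ` does not appear in the `ℓ`-adic
Tate module `V_ℓ(J_X)` then it does not appear in rational points or in `p^∞`-Selmer groups".

D. Mumford, *Abelian Varieties* (1970), §19, Remark p. 169 (not held; as quoted in the tree's `…/AVIsogenyTate`,
`IsIsogeny.exists_nsmul_inverse`): if `f : A → B` is an isogeny there are `g : B → A` and `n > 0` with `g ∘ f = [n]_A` and
`f ∘ g = [n]_B`; §19 first paragraph (p. 172): `Hom(A, B)` is a group under pointwise addition `(f + g)(x) = f(x) + g(x)`.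

E. Kani, M. Rosen, *Idempotent relations and factors of Jacobians*, Math. Ann. **284** (1989), Thm. 3 / Thm. B
(paywalled, acq-09882; restated VERBATIM in the tree files cited above); D. Prasad, C. S. Rajan, J. Number Theory **99**
(2003), Cor. 4; V. Dokchitser et al., loc. cit., Example 1.4 ("`S_3` has the Brauer relation
`Θ = 2C_2 + C_3 − 2S_3 − {1}`").

## Dictionary and what is proved (namespace `Literature.AlgebraicGeometry.Motives.AbelianVariety`)

`A(L) = A.Points L` (a `CommGroup`, written multiplicatively by Mathlib's `Hom.commGroup`; additively as
`Additive (A.Points L)`); for `f : A ⟶ B` the induced homomorphism is Mathlib's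
`IsMonHom.monoidHom f.hom.hom.hom (specOver K L) : A(L) →* B(L)`, `P ↦ P ≫ f` (additively `MonoidHom.toAdditive _`);
`A(L)_ℚ := ℚ ⊗[ℤ] Additive (A.Points L)` with `f_ℚ = (MonoidHom.toAdditive _).toIntLinearMap.baseChange ℚ`;
`rk A(L) := Module.finrank ℚ A(L)_ℚ`.  Products are Mathlib biproducts `⊞`, `⨁`; `B_H = Im N_H = image N`,
`End.of N = Σ_{h ∈ H} ρ h` for `ρ : G →* End X`; `(1_H)^G = indClassFun H 1`.

* §1 the points functor (any `K`, any field `L ⊇ K`): `monoidHom_points_apply`, `toAdditive_monoidHom_points_add`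
  (`(f + g)(P) = f(P) + g(P)`), `…_zero`, `…_id`, `…_comp`, `…_zsmul_id` (`[n]_A` acts as `n` on `A(L)`),
  `points_eq_one_of_id_eq_zero` (`0(L) = {1}`).
* §2 isogeny invariance: `exists_linearEquiv_baseChange_of_comp_eq_nsmul` (pure algebra: `ψφ = n = φψ` ⟹ `φ_ℚ` is an
  isomorphism with inverse `n⁻¹ ψ_ℚ`), **`IsIsogeny.exists_linearEquiv_points`** (an isogeny `f` induces
  `f_ℚ : A(L)_ℚ ≅ B(L)_ℚ`), **`IsIsogenous.nonempty_linearEquiv_points`**, **`IsIsogenous.finrank_points_eq`**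
  (`rk A(L) = rk B(L)`), `IsIsogenous.module_finite_points_iff`.
* §3 additivity: **`exists_addEquiv_points_biprod`** (`(A ⊞ B)(L) ≃+ A(L) × B(L)`, `P ↦ (fst P, snd P)`),
  **`nonempty_linearEquiv_points_biprod`** (`(A ⊞ B)(L)_ℚ ≅ A(L)_ℚ × B(L)_ℚ`), `module_finite_points_biprod`,
  **`finrank_points_biprod`** (`rk (A ⊞ B)(L) = rk A(L) + rk B(L)` for finite ranks), `module_finite_points_biproduct`,
  **`finrank_points_biproduct`** (`rk (⨁_i A_i)(L) = Σ_i rk A_i(L)`), `finrank_points_biproduct_const`.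
* §4 the rank shadows (perfect `K`, finite ranks): **`sum_mul_finrank_points_eq_of_sum_smul_indClassFun_one_eq`**
  (`Σ_i a_i (1_{H_i})^G = Σ_j a'_j (1_{H'_j})^G ⟹ Σ_i a_i rk B_{H_i}(L) = Σ_j a'_j rk B_{H'_j}(L)`),
  **`sum_intCast_mul_finrank_points_eq_zero_of_sum_intCast_smul_indClassFun_one_eq_zero`** (a Brauer relation:
  `Σ_i n_i rk B_{H_i}(L) = 0`), **`finrank_points_mul_add_eq_of_partition`** (Theorem B),
  **`finrank_points_eq_of_gassmann`** (no finiteness needed), **`two_mul_finrank_points_add_symmetricThree`** (`S_3`).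

Scope (stated, not hidden).  (1) No Mordell–Weil theorem is proved or assumed: the `ℚ`-linear isomorphisms hold for every
field `L ⊇ K`; the rank identities carry explicit `Module.Finite ℚ (B(L)_ℚ)` hypotheses for the abelian varieties that
occur (true for number fields `L` by Mordell–Weil).  (2) The Kani–Rosen applications need a perfect base field (the
tree's Poincaré reducibility).  (3) `B_H = Im N_H`; no claim about quotient curves or their Jacobians.
-/

noncomputable section

open CategoryTheory CategoryTheory.Limits Equiv
open scoped TensorProduct
open Literature.RepresentationTheory.FiniteGroups
open Literature.NumberTheory.DiophantineGeometry

universe u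

namespace Literature.AlgebraicGeometry.Motives

namespace AbelianVariety

/-! ## §1 The points functor `A ↦ A(L)` is additive -/

section PointsFunctor

variable {K : Type u} [Field K] {A B C : AbelianVariety K} (L : Type u) [Field L] [Algebra K L]

/-- `f(P) = P ≫ f` for `P ∈ A(L)` (Mathlib `IsMonHom.monoidHom`; Mumford §4). [cite: MumfordAV1970, §19 (p. 172, first paragraph)] -/
theorem monoidHom_points_apply (f : A ⟶ B) (P : A.Points L) :
    IsMonHom.monoidHom f.hom.hom.hom (specOver K L) P = AlgPoints.map f.hom.hom.hom P := rfl

/-- **`(f + g)(P) = f(P) + g(P)` on `A(L)`**: the points functor is additive ("`Hom(A, B)` is a group under pointwise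
addition"; the group law of `B` is a `K`-morphism, Mathlib `MonObj.comp_mul`). [cite: MumfordAV1970, §19 (p. 172, first paragraph)] -/
theorem toAdditive_monoidHom_points_add (f g : A ⟶ B) :
    MonoidHom.toAdditive (IsMonHom.monoidHom (f + g).hom.hom.hom (specOver K L)) =
      MonoidHom.toAdditive (IsMonHom.monoidHom f.hom.hom.hom (specOver K L)) +
        MonoidHom.toAdditive (IsMonHom.monoidHom g.hom.hom.hom (specOver K L)) := by
  refine AddMonoidHom.ext fun P ↦ ?_
  apply Additive.toMul.injective
  change AlgPoints.map (f + g).hom.hom.hom (Additive.toMul P) =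
    AlgPoints.map f.hom.hom.hom (Additive.toMul P) * AlgPoints.map g.hom.hom.hom (Additive.toMul P)
  rw [AlgPoints.map_apply, AlgPoints.map_apply, AlgPoints.map_apply, hom_add, Grp.Hom.hom_mul, Mon.Hom.hom_mul,
    MonObj.comp_mul]

/-- `0(P) = 1`: the zero homomorphism kills `A(L)` (Mathlib `MonObj.comp_one`). [cite: MumfordAV1970, §19 (p. 172, first paragraph)] -/
theorem toAdditive_monoidHom_points_zero :
    MonoidHom.toAdditive (IsMonHom.monoidHom (0 : A ⟶ B).hom.hom.hom (specOver K L)) = 0 := by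
  refine AddMonoidHom.ext fun P ↦ ?_
  apply Additive.toMul.injective
  change AlgPoints.map (0 : A ⟶ B).hom.hom.hom (Additive.toMul P) = 1
  rw [AlgPoints.map_apply, hom_zero, Grp.Hom.hom_one, Mon.Hom.hom_one, MonObj.comp_one]

/-- `𝟙_A` acts as the identity on `A(L)` (functoriality). [cite: MumfordAV1970, §19 (p. 172, first paragraph)] -/
theorem toAdditive_monoidHom_points_id (A : AbelianVariety K) :
    MonoidHom.toAdditive (IsMonHom.monoidHom (𝟙 A : A ⟶ A).hom.hom.hom (specOver K L)) = AddMonoidHom.id _ := by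
  refine AddMonoidHom.ext fun P ↦ ?_
  apply Additive.toMul.injective
  change AlgPoints.map (𝟙 A : A ⟶ A).hom.hom.hom (Additive.toMul P) = Additive.toMul P
  exact Category.comp_id _

/-- `(f ≫ g)(P) = g(f(P))` on `A(L)` (functoriality). [cite: MumfordAV1970, §19 (p. 172, first paragraph)] -/
theorem toAdditive_monoidHom_points_comp (f : A ⟶ B) (g : B ⟶ C) :
    MonoidHom.toAdditive (IsMonHom.monoidHom (f ≫ g).hom.hom.hom (specOver K L)) =
      (MonoidHom.toAdditive (IsMonHom.monoidHom g.hom.hom.hom (specOver K L))).comp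
        (MonoidHom.toAdditive (IsMonHom.monoidHom f.hom.hom.hom (specOver K L))) := by
  refine AddMonoidHom.ext fun P ↦ ?_
  apply Additive.toMul.injective
  change AlgPoints.map (f ≫ g).hom.hom.hom (Additive.toMul P) =
    AlgPoints.map g.hom.hom.hom (AlgPoints.map f.hom.hom.hom (Additive.toMul P))
  exact (Category.assoc _ _ _).symm

/-- **`[n]_A` acts on `A(L)` as multiplication by `n`**: the points of `n • 𝟙_A` is `n •` the identity of `A(L)`
(additivity of the points functor). [cite: MumfordAV1970, §19 (p. 172, first paragraph)] -/
theorem toAdditive_monoidHom_points_zsmul_id (A : AbelianVariety K) (n : ℤ) :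
    MonoidHom.toAdditive (IsMonHom.monoidHom (n • 𝟙 A : A ⟶ A).hom.hom.hom (specOver K L)) =
      n • AddMonoidHom.id (Additive (A.Points L)) := by
  -- the additive map `f ↦ f(L)`
  let Φ : (A ⟶ A) →+ (Additive (A.Points L) →+ Additive (A.Points L)) :=
    { toFun := fun f ↦ MonoidHom.toAdditive (IsMonHom.monoidHom f.hom.hom.hom (specOver K L))
      map_zero' := toAdditive_monoidHom_points_zero L
      map_add' := toAdditive_monoidHom_points_add L }
  have h := map_zsmul Φ n (𝟙 A)
  rw [show Φ (𝟙 A) = AddMonoidHom.id _ from toAdditive_monoidHom_points_id L A] at h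
  exact h

/-- The zero abelian variety (`𝟙 Z = 0`) has `Z(L) = {1}`. [cite: MumfordAV1970, §19 (p. 172, first paragraph)] -/
theorem points_eq_one_of_id_eq_zero {Z : AbelianVariety K} (hZ : 𝟙 Z = 0) (P : Z.Points L) : P = 1 := by
  have h := congrArg (fun φ : Additive (Z.Points L) →+ Additive (Z.Points L) ↦ Additive.toMul (φ (Additive.ofMul P)))
    (toAdditive_monoidHom_points_id L Z)
  rw [hZ, toAdditive_monoidHom_points_zero] at h
  exact h.symm

end PointsFunctor

/-! ## §2 `A(L) ⊗ ℚ` is an isogeny invariant -/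

section Isogeny

variable {K : Type u} [Field K] {A B : AbelianVariety K} (L : Type u) [Field L] [Algebra K L]

/-- `f_ℚ ∘ (n⁻¹ g_ℚ) = 1` on `ℚ ⊗ Q` whenever `f g = n` on `Q` (`n` invertible in `ℚ`). [cite: MumfordAV1970, §19 Remark p. 169] -/
private theorem baseChange_comp_inv_smul_baseChange_eq_id {P Q : Type*} [AddCommGroup P] [AddCommGroup Q]
    (f : P →+ Q) (g : Q →+ P) {n : ℕ} (hn : (n : ℚ) ≠ 0) (hfg : ∀ y, f (g y) = n • y) :
    f.toIntLinearMap.baseChange ℚ ∘ₗ ((n : ℚ)⁻¹ • g.toIntLinearMap.baseChange ℚ) = LinearMap.id := by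
  refine LinearMap.ext fun x ↦ ?_
  rw [LinearMap.comp_apply, LinearMap.smul_apply, map_smul, LinearMap.id_apply]
  induction x using TensorProduct.induction_on with
  | zero => rw [map_zero, map_zero, smul_zero]
  | add x y hx hy => rw [map_add, map_add, smul_add, hx, hy]
  | tmul a q =>
    rw [LinearMap.baseChange_tmul, LinearMap.baseChange_tmul, AddMonoidHom.coe_toIntLinearMap,
      AddMonoidHom.coe_toIntLinearMap, hfg, ← natCast_zsmul, TensorProduct.tmul_smul, ← Int.cast_smul_eq_zsmul ℚ,
      Int.cast_natCast, inv_smul_smul₀ hn]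

/-- Pure algebra: additive maps `φ : M → N`, `ψ : N → M` of abelian groups with `ψ φ = n`, `φ ψ = n`, `n ≥ 1`, give
mutually inverse `ℚ`-linear maps `φ_ℚ`, `n⁻¹ ψ_ℚ` between `ℚ ⊗ M` and `ℚ ⊗ N`. [cite: MumfordAV1970, §19 Remark p. 169] -/
theorem exists_linearEquiv_baseChange_of_comp_eq_nsmul {M N : Type*} [AddCommGroup M] [AddCommGroup N]
    (φ : M →+ N) (ψ : N →+ M) {n : ℕ} (hn : 0 < n) (hψφ : ∀ x, ψ (φ x) = n • x) (hφψ : ∀ y, φ (ψ y) = n • y) :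
    ∃ e : (ℚ ⊗[ℤ] M) ≃ₗ[ℚ] (ℚ ⊗[ℤ] N), (e : ℚ ⊗[ℤ] M →ₗ[ℚ] ℚ ⊗[ℤ] N) = φ.toIntLinearMap.baseChange ℚ := by
  have hn0 : (n : ℚ) ≠ 0 := by exact_mod_cast hn.ne'
  refine ⟨LinearEquiv.ofLinear (φ.toIntLinearMap.baseChange ℚ) ((n : ℚ)⁻¹ • ψ.toIntLinearMap.baseChange ℚ)
    (baseChange_comp_inv_smul_baseChange_eq_id φ ψ hn0 hφψ) ?_, rfl⟩
  rw [LinearMap.smul_comp, ← LinearMap.comp_smul]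
  exact baseChange_comp_inv_smul_baseChange_eq_id ψ φ hn0 hψφ

/-- **An isogeny `f : A → B` induces a `ℚ`-linear isomorphism `f_ℚ : A(L) ⊗ ℚ ≅ B(L) ⊗ ℚ`** for every field `L ⊇ K`: with a
quasi-inverse `g`, `g f = [n]_A`, `f g = [n]_B`, `n ≥ 1` (`IsIsogeny.exists_nsmul_inverse_holds`), the maps `f_ℚ` and
`n⁻¹ g_ℚ` are mutually inverse. [cite: MumfordAV1970, §19 Remark p. 169] [cite: DokchitserEtAl2022, §3 (additive functor lemma)] -/
theorem IsIsogeny.exists_linearEquiv_points {f : A ⟶ B} (hf : IsIsogeny f) :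
    ∃ e : (ℚ ⊗[ℤ] Additive (A.Points L)) ≃ₗ[ℚ] (ℚ ⊗[ℤ] Additive (B.Points L)),
      (e : _ →ₗ[ℚ] _) = (MonoidHom.toAdditive (IsMonHom.monoidHom f.hom.hom.hom (specOver K L))).toIntLinearMap.baseChange ℚ := by
  obtain ⟨g, n, hn, hfg, hgf⟩ := IsIsogeny.exists_nsmul_inverse_holds (A := A) (B := B) hf
  have hT : ∀ {P Q : AbelianVariety K} (u : P ⟶ Q) (v : Q ⟶ P), u ≫ v = n • 𝟙 P → ∀ x,
      MonoidHom.toAdditive (IsMonHom.monoidHom v.hom.hom.hom (specOver K L))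
        (MonoidHom.toAdditive (IsMonHom.monoidHom u.hom.hom.hom (specOver K L)) x) = n • x := by
    intro P Q u v huv x
    have h := DFunLike.congr_fun (toAdditive_monoidHom_points_comp L u v) x
    rw [huv, ← natCast_zsmul, toAdditive_monoidHom_points_zsmul_id, natCast_zsmul, AddMonoidHom.comp_apply] at h
    rw [← h]
    rfl
  exact exists_linearEquiv_baseChange_of_comp_eq_nsmul _ _ hn (hT f g hfg) (hT g f hgf)

/-- **Isogenous abelian varieties have `ℚ`-isomorphic rational points**: `A ∼ B ⟹ A(L) ⊗ ℚ ≅ B(L) ⊗ ℚ` for every field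
`L ⊇ K`. [cite: MumfordAV1970, §19 Remark p. 169] [cite: DokchitserEtAl2022, §1.3 and §3] -/
theorem IsIsogenous.nonempty_linearEquiv_points (h : IsIsogenous A B) :
    Nonempty ((ℚ ⊗[ℤ] Additive (A.Points L)) ≃ₗ[ℚ] (ℚ ⊗[ℤ] Additive (B.Points L))) := by
  obtain ⟨f, hf⟩ := h
  obtain ⟨e, -⟩ := hf.exists_linearEquiv_points L
  exact ⟨e⟩

/-- **The Mordell–Weil rank is an isogeny invariant: `rk A(L) = rk B(L)` for `A ∼ B`** (`rk = dim_ℚ (ℚ ⊗ A(L))`, equal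
junk values `0` included). [cite: MumfordAV1970, §19 Remark p. 169] [cite: DokchitserEtAl2022, §1 (p. 5) and §3] -/
theorem IsIsogenous.finrank_points_eq (h : IsIsogenous A B) :
    Module.finrank ℚ (ℚ ⊗[ℤ] Additive (A.Points L)) = Module.finrank ℚ (ℚ ⊗[ℤ] Additive (B.Points L)) := by
  obtain ⟨e⟩ := h.nonempty_linearEquiv_points L
  exact e.finrank_eq

/-- `A(L) ⊗ ℚ` is finite-dimensional iff `B(L) ⊗ ℚ` is, for `A ∼ B`. [cite: MumfordAV1970, §19 Remark p. 169] -/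
theorem IsIsogenous.module_finite_points_iff (h : IsIsogenous A B) :
    Module.Finite ℚ (ℚ ⊗[ℤ] Additive (A.Points L)) ↔ Module.Finite ℚ (ℚ ⊗[ℤ] Additive (B.Points L)) := by
  obtain ⟨e⟩ := h.nonempty_linearEquiv_points L
  exact ⟨fun _ ↦ Module.Finite.equiv e, fun _ ↦ Module.Finite.equiv e.symm⟩

end Isogeny

/-! ## §3 Additivity: `(A ⊞ B)(L) ≃ A(L) × B(L)` -/

section Biprod

variable {K : Type u} [Field K] (A B : AbelianVariety K) (L : Type u) [Field L] [Algebra K L]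

/-- **`(A ⊞ B)(L) ≃+ A(L) × B(L)`**, `P ↦ (fst P, snd P)` with inverse `(P, Q) ↦ inl P + inr Q` (the points functor is
additive: `inl fst + inr snd = 𝟙`, `fst inl = 𝟙`, `snd inl = 0`, …). [cite: DokchitserEtAl2022, §3 (additive functor lemma)] [cite: MumfordAV1970, §19 (p. 172, first paragraph)] -/
theorem exists_addEquiv_points_biprod :
    ∃ e : Additive ((A ⊞ B).Points L) ≃+ Additive (A.Points L) × Additive (B.Points L),
      ∀ P, e P = (MonoidHom.toAdditive (IsMonHom.monoidHom (biprod.fst : A ⊞ B ⟶ A).hom.hom.hom (specOver K L)) P,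
        MonoidHom.toAdditive (IsMonHom.monoidHom (biprod.snd : A ⊞ B ⟶ B).hom.hom.hom (specOver K L)) P) := by
  let F : ∀ {P Q : AbelianVariety K}, (P ⟶ Q) → (Additive (P.Points L) →+ Additive (Q.Points L)) :=
    fun u ↦ MonoidHom.toAdditive (IsMonHom.monoidHom u.hom.hom.hom (specOver K L))
  have hcomp : ∀ {P Q R : AbelianVariety K} (u : P ⟶ Q) (v : Q ⟶ R), F (u ≫ v) = (F v).comp (F u) :=
    fun u v ↦ toAdditive_monoidHom_points_comp L u v
  have h11 : (F (biprod.fst : A ⊞ B ⟶ A)).comp (F (biprod.inl : A ⟶ A ⊞ B)) = AddMonoidHom.id _ := by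
    rw [← hcomp, biprod.inl_fst]; exact toAdditive_monoidHom_points_id L A
  have h12 : (F (biprod.fst : A ⊞ B ⟶ A)).comp (F (biprod.inr : B ⟶ A ⊞ B)) = 0 := by
    rw [← hcomp, biprod.inr_fst]; exact toAdditive_monoidHom_points_zero L
  have h21 : (F (biprod.snd : A ⊞ B ⟶ B)).comp (F (biprod.inl : A ⟶ A ⊞ B)) = 0 := by
    rw [← hcomp, biprod.inl_snd]; exact toAdditive_monoidHom_points_zero L
  have h22 : (F (biprod.snd : A ⊞ B ⟶ B)).comp (F (biprod.inr : B ⟶ A ⊞ B)) = AddMonoidHom.id _ := by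
    rw [← hcomp, biprod.inr_snd]; exact toAdditive_monoidHom_points_id L B
  have htot : (F (biprod.inl : A ⟶ A ⊞ B)).comp (F biprod.fst) + (F (biprod.inr : B ⟶ A ⊞ B)).comp (F biprod.snd) =
      AddMonoidHom.id _ := by
    rw [← hcomp, ← hcomp, ← toAdditive_monoidHom_points_add, biprod.total]; exact toAdditive_monoidHom_points_id L _
  refine ⟨AddMonoidHom.toAddEquiv ((F biprod.fst).prod (F biprod.snd)) ((F biprod.inl).coprod (F biprod.inr)) ?_ ?_,
    fun P ↦ rfl⟩
  · refine AddMonoidHom.ext fun P ↦ ?_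
    have h := DFunLike.congr_fun htot P
    simpa only [AddMonoidHom.comp_apply, AddMonoidHom.coprod_apply, AddMonoidHom.prod_apply, AddMonoidHom.add_apply,
      AddMonoidHom.id_apply] using h
  · have e11 := fun a ↦ DFunLike.congr_fun h11 a
    have e12 := fun a ↦ DFunLike.congr_fun h12 a
    have e21 := fun a ↦ DFunLike.congr_fun h21 a
    have e22 := fun a ↦ DFunLike.congr_fun h22 a
    simp only [AddMonoidHom.comp_apply, AddMonoidHom.id_apply, AddMonoidHom.zero_apply] at e11 e12 e21 e22
    refine AddMonoidHom.ext fun x ↦ Prod.ext ?_ ?_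
    · simp only [AddMonoidHom.comp_apply, AddMonoidHom.coprod_apply, map_add, Prod.fst_add, AddMonoidHom.prod_apply,
        e11, e12, add_zero, AddMonoidHom.id_apply]
    · simp only [AddMonoidHom.comp_apply, AddMonoidHom.coprod_apply, map_add, Prod.snd_add, AddMonoidHom.prod_apply,
        e21, e22, zero_add, AddMonoidHom.id_apply]

/-- **`(A ⊞ B)(L) ⊗ ℚ ≅ (A(L) ⊗ ℚ) × (B(L) ⊗ ℚ)`** (`ℚ`-linearly). [cite: DokchitserEtAl2022, §3 (additive functor lemma)] -/
theorem nonempty_linearEquiv_points_biprod :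
    Nonempty ((ℚ ⊗[ℤ] Additive ((A ⊞ B).Points L)) ≃ₗ[ℚ]
      (ℚ ⊗[ℤ] Additive (A.Points L)) × (ℚ ⊗[ℤ] Additive (B.Points L))) := by
  obtain ⟨e, -⟩ := exists_addEquiv_points_biprod A B L
  exact ⟨(e.toIntLinearEquiv.baseChange ℤ ℚ _ _).trans (TensorProduct.prodRight ℤ ℚ ℚ _ _)⟩

/-- `(A ⊞ B)(L) ⊗ ℚ` is finite-dimensional when `A(L) ⊗ ℚ` and `B(L) ⊗ ℚ` are. [cite: DokchitserEtAl2022, §3 (additive functor lemma)] -/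
theorem module_finite_points_biprod [Module.Finite ℚ (ℚ ⊗[ℤ] Additive (A.Points L))]
    [Module.Finite ℚ (ℚ ⊗[ℤ] Additive (B.Points L))] : Module.Finite ℚ (ℚ ⊗[ℤ] Additive ((A ⊞ B).Points L)) := by
  obtain ⟨e⟩ := nonempty_linearEquiv_points_biprod A B L
  exact Module.Finite.equiv e.symm

/-- **`rk (A ⊞ B)(L) = rk A(L) + rk B(L)`** when `A(L) ⊗ ℚ` and `B(L) ⊗ ℚ` are finite-dimensional.
[cite: DokchitserEtAl2022, §1 (p. 5) and §3 (additive functor lemma)] -/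
theorem finrank_points_biprod [Module.Finite ℚ (ℚ ⊗[ℤ] Additive (A.Points L))]
    [Module.Finite ℚ (ℚ ⊗[ℤ] Additive (B.Points L))] :
    Module.finrank ℚ (ℚ ⊗[ℤ] Additive ((A ⊞ B).Points L)) =
      Module.finrank ℚ (ℚ ⊗[ℤ] Additive (A.Points L)) + Module.finrank ℚ (ℚ ⊗[ℤ] Additive (B.Points L)) := by
  obtain ⟨e⟩ := nonempty_linearEquiv_points_biprod A B L
  rw [e.finrank_eq, Module.finrank_prod]

variable {A B L}

/-- The zero abelian variety (`𝟙 Z = 0`) has `Z(L) ⊗ ℚ = 0`: finite-dimensional of rank `0`. [cite: MumfordAV1970, §19 (p. 172, first paragraph)] -/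
theorem module_finite_points_and_finrank_eq_zero_of_id_eq_zero {Z : AbelianVariety K} (hZ : 𝟙 Z = 0) :
    Module.Finite ℚ (ℚ ⊗[ℤ] Additive (Z.Points L)) ∧ Module.finrank ℚ (ℚ ⊗[ℤ] Additive (Z.Points L)) = 0 := by
  haveI : Subsingleton (Additive (Z.Points L)) :=
    ⟨fun P Q ↦ Additive.toMul.injective (by
      rw [points_eq_one_of_id_eq_zero L hZ (Additive.toMul P), points_eq_one_of_id_eq_zero L hZ (Additive.toMul Q)])⟩
  haveI : Subsingleton (ℚ ⊗[ℤ] Additive (Z.Points L)) := inferInstance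
  exact ⟨inferInstance, Module.finrank_zero_of_subsingleton⟩

/-- `(⨁_{i < n+1} fᵢ) ∼ f₀ ⊞ ⨁_{i < n} f_{i+1}` (the splitting isomorphism of Mathlib's finite and binary biproducts).
[cite: MumfordAV1970, §19 (p. 172)] -/
private theorem isIsogenous_biproduct_head_tail' {n : ℕ} (f : Fin (n + 1) → AbelianVariety K) :
    IsIsogenous (⨁ f) (f 0 ⊞ ⨁ fun i : Fin n ↦ f i.succ) := by
  classical
  let e : (⨁ f) ≅ (f 0 ⊞ ⨁ fun i : Fin n ↦ f i.succ) :=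
    { hom := biprod.lift (biproduct.π f 0) (biproduct.lift fun i : Fin n ↦ biproduct.π f i.succ)
      inv := biprod.desc (biproduct.ι f 0) (biproduct.desc fun i : Fin n ↦ biproduct.ι f i.succ)
      hom_inv_id := by
        rw [biprod.lift_desc, biproduct.lift_desc, ← biproduct.total, Fin.sum_univ_succ]
      inv_hom_id := by
        refine biprod.hom_ext' _ _ ?_ ?_
        · rw [biprod.inl_desc_assoc, Category.comp_id]
          refine biprod.hom_ext _ _ ?_ ?_
          · rw [Category.assoc, biprod.lift_fst, biproduct.ι_π_self, biprod.inl_fst]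
          · rw [Category.assoc, biprod.lift_snd, biprod.inl_snd]
            refine biproduct.hom_ext _ _ fun i ↦ ?_
            rw [Category.assoc, biproduct.lift_π, biproduct.ι_π_ne _ (Fin.succ_ne_zero i).symm, Limits.zero_comp]
        · rw [biprod.inr_desc_assoc, Category.comp_id]
          refine biprod.hom_ext _ _ ?_ ?_
          · rw [Category.assoc, biprod.lift_fst, biprod.inr_fst]
            refine biproduct.hom_ext' _ _ fun i ↦ ?_
            rw [biproduct.ι_desc_assoc, biproduct.ι_π_ne _ (Fin.succ_ne_zero i), Limits.comp_zero]
          · rw [Category.assoc, biprod.lift_snd, biprod.inr_snd]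
            refine biproduct.hom_ext' _ _ fun i ↦ biproduct.hom_ext _ _ fun i' ↦ ?_
            rw [biproduct.ι_desc_assoc, Category.assoc, biproduct.lift_π, Category.comp_id]
            by_cases hii' : i = i'
            · subst hii'
              rw [biproduct.ι_π_self, biproduct.ι_π_self]
            · rw [biproduct.ι_π_ne _ hii', biproduct.ι_π_ne _ (fun h ↦ hii' (Fin.succ_injective _ h))] }
  exact ⟨e.hom, isIsogeny_hom_of_iso e⟩

/-- `(⨁_{i<n} fᵢ)(L) ⊗ ℚ` is finite-dimensional of rank `Σᵢ rk fᵢ(L)` when every `fᵢ(L) ⊗ ℚ` is finite-dimensional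
(induction on `n`). [cite: DokchitserEtAl2022, §3 (additive functor lemma)] -/
private theorem module_finite_points_and_finrank_biproduct_fin (L : Type u) [Field L] [Algebra K L] :
    ∀ {n : ℕ} (f : Fin n → AbelianVariety K), (∀ i, Module.Finite ℚ (ℚ ⊗[ℤ] Additive ((f i).Points L))) →
      Module.Finite ℚ (ℚ ⊗[ℤ] Additive ((⨁ f).Points L)) ∧
        Module.finrank ℚ (ℚ ⊗[ℤ] Additive ((⨁ f).Points L)) = ∑ i, Module.finrank ℚ (ℚ ⊗[ℤ] Additive ((f i).Points L))
  | 0, f, _ => by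
    rw [Finset.univ_eq_empty, Finset.sum_empty]
    exact module_finite_points_and_finrank_eq_zero_of_id_eq_zero (biproduct.hom_ext _ _ fun j ↦ Fin.elim0 j)
  | n + 1, f, hf => by
    obtain ⟨hfin, hrk⟩ := module_finite_points_and_finrank_biproduct_fin L (fun i : Fin n ↦ f i.succ) fun i ↦ hf i.succ
    haveI := hfin
    haveI := hf 0
    haveI := module_finite_points_biprod (f 0) (⨁ fun i : Fin n ↦ f i.succ) L
    have hiso := isIsogenous_biproduct_head_tail' f
    refine ⟨(hiso.module_finite_points_iff L).2 inferInstance, ?_⟩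
    rw [hiso.finrank_points_eq L, finrank_points_biprod, hrk, Fin.sum_univ_succ]

/-- `(⨁_i A_i)(L) ⊗ ℚ` is finite-dimensional when every `A_i(L) ⊗ ℚ` is. [cite: DokchitserEtAl2022, §3 (additive functor lemma)] -/
theorem module_finite_points_biproduct {ι : Type} [Fintype ι] (f : ι → AbelianVariety K) (L : Type u) [Field L] [Algebra K L]
    [∀ i, Module.Finite ℚ (ℚ ⊗[ℤ] Additive ((f i).Points L))] : Module.Finite ℚ (ℚ ⊗[ℤ] Additive ((⨁ f).Points L)) := by
  classical
  have hiso : IsIsogenous (⨁ (f ∘ (Fintype.equivFin ι).symm)) (⨁ f) :=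
    ⟨_, isIsogeny_hom_of_iso (biproduct.reindex (Fintype.equivFin ι).symm f)⟩
  exact (hiso.module_finite_points_iff L).1
    (module_finite_points_and_finrank_biproduct_fin L (f ∘ (Fintype.equivFin ι).symm) fun i ↦
      show Module.Finite ℚ (ℚ ⊗[ℤ] Additive ((f ((Fintype.equivFin ι).symm i)).Points L)) from inferInstance).1

/-- **`rk (⨁_i A_i)(L) = Σ_i rk A_i(L)`** when every `A_i(L) ⊗ ℚ` is finite-dimensional.
[cite: DokchitserEtAl2022, §1 (p. 5) and §3 (additive functor lemma)] -/
theorem finrank_points_biproduct {ι : Type} [Fintype ι] (f : ι → AbelianVariety K) (L : Type u) [Field L] [Algebra K L]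
    [∀ i, Module.Finite ℚ (ℚ ⊗[ℤ] Additive ((f i).Points L))] :
    Module.finrank ℚ (ℚ ⊗[ℤ] Additive ((⨁ f).Points L)) = ∑ i, Module.finrank ℚ (ℚ ⊗[ℤ] Additive ((f i).Points L)) := by
  classical
  have hiso : IsIsogenous (⨁ (f ∘ (Fintype.equivFin ι).symm)) (⨁ f) :=
    ⟨_, isIsogeny_hom_of_iso (biproduct.reindex (Fintype.equivFin ι).symm f)⟩
  rw [← hiso.finrank_points_eq L,
    (module_finite_points_and_finrank_biproduct_fin L (f ∘ (Fintype.equivFin ι).symm) fun i ↦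
      show Module.Finite ℚ (ℚ ⊗[ℤ] Additive ((f ((Fintype.equivFin ι).symm i)).Points L)) from inferInstance).2]
  exact Fintype.sum_equiv (Fintype.equivFin ι).symm _ _ fun i ↦ rfl

/-- `rk (Y^n)(L) = n · rk Y(L)` for finite rank. [cite: DokchitserEtAl2022, §3 (additive functor lemma)] -/
theorem finrank_points_biproduct_const {ι : Type} [Fintype ι] (Y : AbelianVariety K) (L : Type u) [Field L] [Algebra K L]
    [Module.Finite ℚ (ℚ ⊗[ℤ] Additive (Y.Points L))] :
    Module.finrank ℚ (ℚ ⊗[ℤ] Additive ((⨁ fun _ : ι ↦ Y).Points L)) =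
      Fintype.card ι * Module.finrank ℚ (ℚ ⊗[ℤ] Additive (Y.Points L)) := by
  rw [finrank_points_biproduct, Finset.sum_const, Finset.card_univ, smul_eq_mul]

end Biprod

/-! ## §4 The Mordell–Weil rank shadows of the Kani–Rosen / Brauer-relation isogenies -/

section BrauerRelations

variable {K : Type u} [Field K] [PerfectField K] (L : Type u) [Field L] [Algebra K L] {X : AbelianVariety K}
  {G : Type} [Group G] [Fintype G] [DecidableEq G] (ρ : G →* End X) {ι ι' : Type} [Fintype ι] [Fintype ι']
  [DecidableEq ι] [DecidableEq ι'] (H : ι → Subgroup G) (H' : ι' → Subgroup G) [∀ i, Fintype (H i)]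
  [∀ j, Fintype (H' j)] {N : ι → (X ⟶ X)} {N' : ι' → (X ⟶ X)} (a : ι → ℕ) (a' : ι' → ℕ)

/-- **From an identity of permutation characters to an identity of Mordell–Weil ranks**: if
`Σ_i a_i (1_{H_i})^G = Σ_j a'_j (1_{H'_j})^G`, then for every action `ρ : G → End X` on an abelian variety over a perfect
field `K`, every field `L ⊇ K` over which the `B_H(L) ⊗ ℚ` involved are finite-dimensional,
**`Σ_i a_i rk B_{H_i}(L) = Σ_j a'_j rk B_{H'_j}(L)`** (`B_H = Im N_H`) — Kani–Rosen's Theorem 3 (the tree's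
`isIsogenous_of_sum_smul_indClassFun_one_eq`) read on rational points. [cite: KaniRosen1989, Thm. 3] [cite: DokchitserEtAl2022, §1.3 Thm. 1.3 and §1 (p. 5)] -/
theorem sum_mul_finrank_points_eq_of_sum_smul_indClassFun_one_eq
    (h : ∑ i, (a i : ℂ) • indClassFun (H i) (1 : H i → ℂ) = ∑ j, (a' j : ℂ) • indClassFun (H' j) (1 : H' j → ℂ))
    (hN : ∀ i, End.of (N i) = ∑ h : H i, ρ h) (hN' : ∀ j, End.of (N' j) = ∑ h : H' j, ρ h)
    [∀ i, Module.Finite ℚ (ℚ ⊗[ℤ] Additive ((image (N i)).Points L))]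
    [∀ j, Module.Finite ℚ (ℚ ⊗[ℤ] Additive ((image (N' j)).Points L))] :
    ∑ i, a i * Module.finrank ℚ (ℚ ⊗[ℤ] Additive ((image (N i)).Points L)) =
      ∑ j, a' j * Module.finrank ℚ (ℚ ⊗[ℤ] Additive ((image (N' j)).Points L)) := by
  have key := (isIsogenous_of_sum_smul_indClassFun_one_eq ρ H H' a a' h hN hN').finrank_points_eq L
  haveI : ∀ i, Module.Finite ℚ (ℚ ⊗[ℤ] Additive ((⨁ fun _ : Fin (a i) ↦ image (N i)).Points L)) :=
    fun i ↦ module_finite_points_biproduct _ L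
  haveI : ∀ j, Module.Finite ℚ (ℚ ⊗[ℤ] Additive ((⨁ fun _ : Fin (a' j) ↦ image (N' j)).Points L)) :=
    fun j ↦ module_finite_points_biproduct _ L
  rw [finrank_points_biproduct _ L, finrank_points_biproduct _ L] at key
  simpa only [finrank_points_biproduct_const, Fintype.card_fin] using key

omit [Fintype ι'] [DecidableEq ι'] in
/-- **A Brauer relation `Θ = Σ_i n_i H_i` gives `Σ_i n_i rk B_{H_i}(L) = 0`** for every `G`-action on an abelian variety
over a perfect field and every field `L ⊇ K` over which the `B_{H_i}(L) ⊗ ℚ` are finite-dimensional ("For every Brauer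
relation … there is an isogeny `∏_j Jac_{X/H_j'} → ∏_i Jac_{X/H_i}`", read on Mordell–Weil ranks).
[cite: DokchitserEtAl2022, §1.3 Thm. 1.3 and §1 (p. 5)] [cite: KaniRosen1989, Thm. 3] -/
theorem sum_intCast_mul_finrank_points_eq_zero_of_sum_intCast_smul_indClassFun_one_eq_zero (n : ι → ℤ)
    (h0 : ∑ i, (n i : ℂ) • indClassFun (H i) (1 : H i → ℂ) = 0) (hN : ∀ i, End.of (N i) = ∑ h : H i, ρ h)
    [∀ i, Module.Finite ℚ (ℚ ⊗[ℤ] Additive ((image (N i)).Points L))] :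
    ∑ i, n i * (Module.finrank ℚ (ℚ ⊗[ℤ] Additive ((image (N i)).Points L)) : ℤ) = 0 := by
  have key := (isIsogenous_of_sum_intCast_smul_indClassFun_one_eq_zero ρ H n h0 hN).finrank_points_eq L
  haveI : ∀ i, Module.Finite ℚ (ℚ ⊗[ℤ] Additive ((⨁ fun _ : Fin (n i).toNat ↦ image (N i)).Points L)) :=
    fun i ↦ module_finite_points_biproduct _ L
  haveI : ∀ i, Module.Finite ℚ (ℚ ⊗[ℤ] Additive ((⨁ fun _ : Fin (-n i).toNat ↦ image (N i)).Points L)) :=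
    fun i ↦ module_finite_points_biproduct _ L
  rw [finrank_points_biproduct _ L, finrank_points_biproduct _ L] at key
  simp only [finrank_points_biproduct_const, Fintype.card_fin] at key
  have key' : (∑ i, ((n i).toNat : ℤ) * Module.finrank ℚ (ℚ ⊗[ℤ] Additive ((image (N i)).Points L))) =
      ∑ i, (((-n i).toNat : ℤ) * Module.finrank ℚ (ℚ ⊗[ℤ] Additive ((image (N i)).Points L))) := by
    exact_mod_cast key
  rw [← sub_eq_zero, ← Finset.sum_sub_distrib] at key'
  rw [← key']
  refine Finset.sum_congr rfl fun i _ ↦ ?_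
  rw [← sub_mul, Int.toNat_sub_toNat_neg]

omit [Fintype ι'] [DecidableEq ι'] [DecidableEq G] in
/-- **Kani–Rosen's Theorem B on Mordell–Weil ranks**: if `G = H_1 ∪ ⋯ ∪ H_t`, `H_i ∩ H_j = 1` (`i ≠ j`), then for every
`G`-action on `X` over a perfect field and every `L ⊇ K` with finite ranks,
**`(t-1) rk X(L) + |G| rk B_G(L) = Σ_i |H_i| rk B_{H_i}(L)`** (the isogeny `X^{t-1} × B_G^{|G|} ∼ ∏_i B_{H_i}^{|H_i|}` is
the tree's `isIsogenous_kaniRosenB`). [cite: KaniRosen1989, Thm. B] [cite: DokchitserEtAl2022, §1 (p. 5)] -/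
theorem finrank_points_mul_add_eq_of_partition {NG : X ⟶ X} (hcover : ∀ g : G, ∃ i, g ∈ H i)
    (hdisj : ∀ i j, i ≠ j → ∀ g : G, g ∈ H i → g ∈ H j → g = 1) (hN : ∀ i, End.of (N i) = ∑ h : H i, ρ h)
    (hNG : End.of NG = ∑ g, ρ g) [Module.Finite ℚ (ℚ ⊗[ℤ] Additive (X.Points L))]
    [Module.Finite ℚ (ℚ ⊗[ℤ] Additive ((image NG).Points L))]
    [∀ i, Module.Finite ℚ (ℚ ⊗[ℤ] Additive ((image (N i)).Points L))] :
    (Fintype.card ι - 1) * Module.finrank ℚ (ℚ ⊗[ℤ] Additive (X.Points L)) +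
        Fintype.card G * Module.finrank ℚ (ℚ ⊗[ℤ] Additive ((image NG).Points L)) =
      ∑ i, Fintype.card (H i) * Module.finrank ℚ (ℚ ⊗[ℤ] Additive ((image (N i)).Points L)) := by
  have key := (isIsogenous_kaniRosenB H ρ hcover hdisj hN hNG).finrank_points_eq L
  haveI := module_finite_points_biproduct (fun _ : Fin (Fintype.card ι - 1) ↦ X) L
  haveI := module_finite_points_biproduct (fun _ : Fin (Fintype.card G) ↦ image NG) L
  haveI : ∀ i, Module.Finite ℚ (ℚ ⊗[ℤ] Additive ((⨁ fun _ : Fin (Fintype.card (H i)) ↦ image (N i)).Points L)) :=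
    fun i ↦ module_finite_points_biproduct _ L
  rw [finrank_points_biprod, finrank_points_biproduct_const, finrank_points_biproduct_const,
    finrank_points_biproduct _ L] at key
  simpa only [finrank_points_biproduct_const, Fintype.card_fin] using key

end BrauerRelations

section Gassmann

variable {K : Type u} [Field K] [PerfectField K] (L : Type u) [Field L] [Algebra K L] {X : AbelianVariety K}
  {G : Type} [Group G] [Fintype G] (ρ : G →* End X) (H₁ H₂ : Subgroup G) [Fintype H₁] [Fintype H₂] {N₁ N₂ : X ⟶ X}

/-- **Gassmann equivalent subgroups give images with `ℚ`-isomorphic rational points and equal Mordell–Weil ranks**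
(no finiteness needed): `rk B_{H₁}(L) = rk B_{H₂}(L)` for every `G`-action on an abelian variety over a perfect field and
every field `L ⊇ K` (`B_{H₁} ∼ B_{H₂}` is the tree's `isIsogenous_of_gassmann`). [cite: PrasadRajan2003, Cor. 4] [cite: KaniRosen1989, Thm. 3] -/
theorem finrank_points_eq_of_gassmann
    (hG : ∀ g : G, Nat.card {h : H₁ // IsConj g h} = Nat.card {h : H₂ // IsConj g h})
    (hN₁ : End.of N₁ = ∑ h : H₁, ρ h) (hN₂ : End.of N₂ = ∑ h : H₂, ρ h) :
    Module.finrank ℚ (ℚ ⊗[ℤ] Additive ((image N₁).Points L)) =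
      Module.finrank ℚ (ℚ ⊗[ℤ] Additive ((image N₂).Points L)) :=
  (isIsogenous_of_gassmann ρ H₁ H₂ hG hN₁ hN₂).finrank_points_eq L

end Gassmann

section SymmetricThree

variable {K : Type u} [Field K] [PerfectField K] (L : Type u) [Field L] [Algebra K L] {X : AbelianVariety K}
  (ρ : Perm (Fin 3) →* End X) {N₂ N₃ NG : X ⟶ X}

/-- **The `S_3` relation `Θ = 2C_2 + C_3 − 2S_3 − 1` on Mordell–Weil ranks**: for every action of `S_3 = Perm(Fin 3)` on an
abelian variety `X` over a perfect field and every field `L ⊇ K` with finite ranks,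
**`2 rk B_{C_2}(L) + rk B_{C_3}(L) = rk X(L) + 2 rk B_{S_3}(L)`** (the isogeny `B_{C_2}² × B_{C_3} ∼ X × B_{S_3}²` is the
tree's `isIsogenous_symmetricThree_theta`; for the Jacobian of an `S_3`-cover `C → C/S_3` this is the classical
`2 rk J(C/C_2) + rk J(C/C_3) = rk J(C) + 2 rk J(C/S_3)`). [cite: DokchitserEtAl2022, §1.3 Example 1.4 and §1 (p. 5)] [cite: KaniRosen1989, Thm. 3] -/
theorem two_mul_finrank_points_add_symmetricThree
    (hN₂ : End.of N₂ = ∑ h : Subgroup.zpowers (swap (0 : Fin 3) 1), ρ h)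
    (hN₃ : End.of N₃ = ∑ h : Subgroup.zpowers (finRotate 3), ρ h) (hNG : End.of NG = ∑ g, ρ g)
    [Module.Finite ℚ (ℚ ⊗[ℤ] Additive (X.Points L))] [Module.Finite ℚ (ℚ ⊗[ℤ] Additive ((image N₂).Points L))]
    [Module.Finite ℚ (ℚ ⊗[ℤ] Additive ((image N₃).Points L))] [Module.Finite ℚ (ℚ ⊗[ℤ] Additive ((image NG).Points L))] :
    2 * Module.finrank ℚ (ℚ ⊗[ℤ] Additive ((image N₂).Points L)) + Module.finrank ℚ (ℚ ⊗[ℤ] Additive ((image N₃).Points L)) =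
      Module.finrank ℚ (ℚ ⊗[ℤ] Additive (X.Points L)) + 2 * Module.finrank ℚ (ℚ ⊗[ℤ] Additive ((image NG).Points L)) := by
  have key := (isIsogenous_symmetricThree_theta ρ hN₂ hN₃ hNG).finrank_points_eq L
  haveI := module_finite_points_biprod (image N₂) (image N₂) L
  haveI := module_finite_points_biprod (image NG) (image NG) L
  rw [finrank_points_biprod, finrank_points_biprod, finrank_points_biprod, finrank_points_biprod] at key
  omega

end SymmetricThree

end AbelianVariety

end Literature.AlgebraicGeometry.Motives
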